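import Summits.QuantumFields.YangMills.Theorems.BalabanUVNodesN15KingModelAnalyticBlockCovWindow
import Summits.QuantumFields.YangMills.Theorems.BalabanUVNodesN15KingModelAnalyticEffLapLipschitz
import HarnessLib

/-!
# BalabanUVNodes ∕ N15 — THE KING-MODEL RUNG (PART Ϫ-d): THE BLOCK-FIELD COVARIANCE IS A HOLOMORPHIC FUNCTION OF THE LINK VARIABLES — `U ↦ C(U,U⁻¹)` (matrix-valued, and every
# fibre block and entry) is analytic on the open polydisc `‖U_b − U₀_b‖ < s₀(m²,0,d)∕L` around EVERY unitary background `U₀` (any curvature), and ★★★★ `U ↦ (Δ_eff(U,U⁻¹))⁻¹` is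
# analytic on `‖U_b − U₀_b‖ < s₀(m²,a,d)∕L`, where it IS `C(U,U⁻¹)` — NE2's unit layer continues analytically in the background on Bałaban's scale `Θ(η)`; also the matrix-valued
# holomorphy of `Δ_eff(U,V)` and of the continued sandwich (PART Ϩ-m had the entries)
# (Track A, DAG node N15 = NE2; FAN-OUT v1.1 §N15 s3 «KING-MODEL RUNG … + what the curved case adds»; count-neutral)

HONEST FRAMING.  Count-neutral (cell `pub-ymgap`, seat `pub-ymgap-dag-n15-e` g52; `--supports stmt-QuantumFields-27247 --as helper` = K3ᴬ, KEY MAP v3).  King's one-level comparison model,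
massive fine covariance, any fibre `𝕜ⁿ` (`𝕜 = ℝ` or `ℂ`: analyticity over `𝕜`), King's scaling, comb-depth contours.  The Woodbury form `C(U,U⁻¹)` continues to the LARGER polydisc
`s₀(m²,0,d)` (only `B` must be inverted); the identification with `(Δ_eff)⁻¹` is certified on `s₀(m²,a,d) ≤ s₀(m²,0,d)` (PART Ϫ-b).  NOT Bałaban's multi-level objects; NOT a node
discharge (N15 of record untouched); nothing continuum ∕ ℝ⁴ ∕ OS ∕ Clay.

THE RESULTS:
* §1 ★ `analyticAt_matrix_of_entry` (generic: a matrix-valued map is analytic where all its entries are — finite sum of `entry • single`), `isOpen_polydisc` (the open polydiscs of link fields).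
* §2 ON THE LOCUS (two-sided fields): ★★ `analyticAt_cxBlockCov_entry` (`IsUnit B(U₀,V₀)` ⟹ every entry of `(U,V) ↦ C(U,V)` analytic at `(U₀,V₀)`), ★★★ **`analyticAt_cxBlockCov`** (matrix-valued), ★★ `analyticAt_cxSandwich`,
  ★★ `analyticAt_cxEffLap` (matrix-valued upgrades of PART Ϩ-m's entrywise statements).
* §3 PRINT's SLICE AROUND EVERY UNITARY `U₀` (`m² > 0`, `L ≥ 1`, comb depth): ★★★ `analyticAt_printBlockCov` (closed polydisc `Lε ≤ s₀(m²,0,d)`), ★★★★ **`analyticOnNhd_printBlockCov_polydisc`**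
  (`U ↦ C(U,U⁻¹)` analytic on `‖U_b − U₀_b‖ < s₀(m²,0,d)∕L`), ★★★ `analyticOnNhd_blk_printBlockCov_polydisc` (every fibre block), ★★★ `analyticOnNhd_printBlockCov_entry_polydisc` (every entry),
  ★★★★ **`analyticOnNhd_inv_printEffLap_polydisc`** (`a > 0`: `U ↦ (Δ_eff(U,U⁻¹))⁻¹` analytic on `‖U_b − U₀_b‖ < s₀(m²,a,d)∕L`), ★★★ `analyticOnNhd_printEffLap_polydisc` (matrix-valued `Δ_eff(U,U⁻¹)` on
  `s₀(κ,a,d)∕L` for any `κ`-coercive unitary centre — PART Ϩ-m upgraded), `continuousOn_printBlockCov_polydisc`.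
PRIOR TREE ART (by name): Ϫ-a (`cxBlockCov`), Ϫ-b (`inv_cxEffLap_at_massRadius`, `mass_coercive_fullOpU`, `sliceRadius_anti`), Ϩ-m (`analyticAt_cxSandwich_entry`, `analyticAt_cxEffLap_entry`), Ϩ-h (`analyticAt_sliceEmbed`,
`analyticAt_cxFullOp_inv`), Ϩ-g (`isUnit_cxFullOp_at_radius`, `sliceRadius_pos`, `sliceRadius_le`), Ϩ-f (`isUnit_of_near_unitary`), Ϛ-h (`CxLinks`, `cxBlkCLM`, `cxEntryCLM`), Mathlib (`Matrix.matrix_eq_sum_single`,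
`Finset.analyticAt_fun_sum`, `AnalyticAt.congr`, `AnalyticOnNhd.continuousOn`).  Dedup (rg at filing): basename 0 files; needles `analyticAt_matrix_of_entry|analyticAt_cxBlockCov|printBlockCov|isOpen_polydisc` 0 tree files.
Locators: [Balaban1985BackgroundPropagators] §3.B p.399 l.37–40, Thm 3.4 p.400; [King1986] (2.14) p.653, (4.45) p.675.  0 `sorry`, 0 `def`.
-/

noncomputable section
open scoped BigOperators ComplexConjugate ComplexOrder Topology Matrix.Norms.L2Operator
open Finset Matrix Filter Set

namespace Summit.QuantumFields.YangMills.BalabanUVNodes.N15KingModelRung.Analytic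

open Literature.MathematicalPhysics.QuantumFieldTheory.LatticeDiamagneticInequality (blk)
open Literature.MathematicalPhysics.QuantumFieldTheory.Balaban1983to89.B5Prop11Plancherel (Tor fine)
open Summit.QuantumFields.YangMills.BalabanUVNodes.N15KingModelRung.Covariant (CxLinks cxBlkCLM cxEntryCLM fib)
open Summit.QuantumFields.YangMills.BalabanUVNodes.N15KingModelRung.CovariantBlock (BlockTree covQ fullOpU effLapU)

/-! ## §1 Entrywise analyticity is analyticity; the polydiscs are open -/

section Generic

variable {𝕜 : Type*} [RCLike 𝕜] {E : Type*} [NormedAddCommGroup E] [NormedSpace 𝕜 E] {p q : Type*} [Fintype p] [Fintype q] [DecidableEq p] [DecidableEq q]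

/-- ★ A MATRIX-VALUED MAP IS ANALYTIC WHERE ALL ITS ENTRIES ARE (finite dimension: `F(x) = Σ_{ij} F(x)_{ij}•E_{ij}`). [folklore] -/
theorem analyticAt_matrix_of_entry {F : E → Matrix p q 𝕜} {x₀ : E} (h : ∀ i j, AnalyticAt 𝕜 (fun x => F x i j) x₀) : AnalyticAt 𝕜 F x₀ := by
  have e : F = fun x => ∑ i, ∑ j, (F x i j) • Matrix.single i j (1 : 𝕜) := by
    funext x
    conv_lhs => rw [Matrix.matrix_eq_sum_single (F x)]
    refine Finset.sum_congr rfl fun i _ => Finset.sum_congr rfl fun j _ => ?_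
    rw [Matrix.smul_single, smul_eq_mul, mul_one]
  rw [e]
  exact Finset.analyticAt_fun_sum _ fun i _ => Finset.analyticAt_fun_sum _ fun j _ => (h i j).smul analyticAt_const

end Generic

variable {d : ℕ} {L : ℕ} [NeZero L] (T : BlockTree d L) (M : Fin (d + 1) → ℕ) [hM : ∀ μ, NeZero (M μ)]
variable {𝕜 : Type*} [RCLike 𝕜] {n : Type*} [Fintype n] [DecidableEq n]

/-- THE OPEN POLYDISC `{U | ∀ b, ‖U_b − U₀_b‖ < r}` of link fields is open. [folklore] -/
theorem isOpen_polydisc (U₀ : Tor (fine L M) × Fin (d + 1) → Matrix n n 𝕜) (r : ℝ) : IsOpen {U : Tor (fine L M) × Fin (d + 1) → Matrix n n 𝕜 | ∀ bd, ‖U bd - U₀ bd‖ < r} := by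
  rw [Set.setOf_forall]
  exact isOpen_iInter_of_finite fun bd => isOpen_lt (by fun_prop) continuous_const

/-! ## §2 On the invertibility locus of `B`: the Woodbury form is analytic in the two-sided field -/

section Locus

/-- ★★ EVERY ENTRY OF `(U,V) ↦ C(U,V)` IS ANALYTIC at every two-sided field where `B(U,V)` is invertible (PART Ϩ-m's sandwich entries AT ZERO BLOCK COUPLING plus a constant).
[cite: Balaban1985BackgroundPropagators, Thm 3.4 p.400; King1986, (4.45) p.675] -/
theorem analyticAt_cxBlockCov_entry {a c m2 : ℝ} {UV₀ : CxLinks (fine L M) 𝕜 n} (hB : IsUnit (cxFullOp T M 0 c m2 UV₀.1 UV₀.2)) (p p' : Tor M × n) :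
    AnalyticAt 𝕜 (fun UV : CxLinks (fine L M) 𝕜 n => cxBlockCov T M a c m2 UV.1 UV.2 p p') UV₀ := by
  unfold cxBlockCov
  simp only [Matrix.add_apply, Matrix.smul_apply, smul_eq_mul]
  exact analyticAt_const.add (analyticAt_cxSandwich_entry T M hB p p')

/-- ★★★ **THE CONTINUED BLOCK-FIELD COVARIANCE IS ANALYTIC IN THE TWO-SIDED LINK FIELD** (matrix-valued) at every `(U₀,V₀)` with `B(U₀,V₀)` invertible. [cite: Balaban1985BackgroundPropagators, Thm 3.4 p.400; King1986, (4.45) p.675] -/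
theorem analyticAt_cxBlockCov {a c m2 : ℝ} {UV₀ : CxLinks (fine L M) 𝕜 n} (hB : IsUnit (cxFullOp T M 0 c m2 UV₀.1 UV₀.2)) :
    AnalyticAt 𝕜 (fun UV : CxLinks (fine L M) 𝕜 n => cxBlockCov T M a c m2 UV.1 UV.2) UV₀ :=
  analyticAt_matrix_of_entry fun p p' => analyticAt_cxBlockCov_entry T M hB p p'

/-- ★★ THE CONTINUED SANDWICH `Q(U)G(U,V)Q♯_K(V)` IS ANALYTIC (matrix-valued) on the locus of `A`. [cite: Balaban1985BackgroundPropagators, Thm 3.4 p.400; King1986, (2.14) p.653] -/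
theorem analyticAt_cxSandwich {a c m2 : ℝ} {UV₀ : CxLinks (fine L M) 𝕜 n} (hA : IsUnit (cxFullOp T M a c m2 UV₀.1 UV₀.2)) :
    AnalyticAt 𝕜 (fun UV : CxLinks (fine L M) 𝕜 n => covQ T M UV.1 * (cxFullOp T M a c m2 UV.1 UV.2)⁻¹ * cxKingQadj T M UV.2) UV₀ :=
  analyticAt_matrix_of_entry fun p p' => analyticAt_cxSandwich_entry T M hA p p'

/-- ★★ KING's CONTINUED `Δ_eff(U,V)` IS ANALYTIC (matrix-valued) on the locus of `A`. [cite: King1986, (2.14) p.653; Balaban1985BackgroundPropagators, Thm 3.4 p.400] -/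
theorem analyticAt_cxEffLap {a c m2 : ℝ} {UV₀ : CxLinks (fine L M) 𝕜 n} (hA : IsUnit (cxFullOp T M a c m2 UV₀.1 UV₀.2)) :
    AnalyticAt 𝕜 (fun UV : CxLinks (fine L M) 𝕜 n => cxEffLap T M a c m2 UV.1 UV.2) UV₀ :=
  analyticAt_matrix_of_entry fun p p' => analyticAt_cxEffLap_entry T M hA p p'

end Locus

/-! ## §3 Print's slice around every unitary background -/

section Slice

variable (hD : ∀ j, T.depth j ≤ (d + 1) * (L - 1)) (a : ℝ) {m2 : ℝ} (hm : 0 < m2) (hL : 1 ≤ L)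
variable {U₀ : Tor (fine L M) × Fin (d + 1) → Matrix n n 𝕜} (hU₀ : ∀ bd, U₀ bd ∈ Matrix.unitaryGroup n 𝕜)
include hD hm hL hU₀

omit [NeZero L] hM hD hm hU₀ in
/-- Inside a polydisc of radius `≤ s₀(κ,a′,d)∕L` every fibre block is within `1` of a unitary, hence invertible. [cite: Balaban1985BackgroundPropagators, §3.B p.399 l.37–40] -/
theorem isUnit_links_of_polydisc (hU₀ : ∀ bd, U₀ bd ∈ Matrix.unitaryGroup n 𝕜) {κ a' : ℝ} {U : Tor (fine L M) × Fin (d + 1) → Matrix n n 𝕜} {ε : ℝ} (hU : ∀ bd, ‖U bd - U₀ bd‖ ≤ ε)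
    (hrad : (L : ℝ) * ε ≤ sliceRadius κ a' d) : ∀ bd, IsUnit (U bd) := by
  have hε1 : ε < 1 := by
    have hL1 : (1 : ℝ) ≤ L := by exact_mod_cast hL
    have h := hrad.trans (sliceRadius_le κ a' d).1
    have hd : (4 : ℝ) ≤ 4 * ((d : ℝ) + 1) := by have : (0 : ℝ) ≤ d := Nat.cast_nonneg d; linarith
    have h2 : (L : ℝ) * ε ≤ 1 / 4 := h.trans (one_div_le_one_div_of_le (by norm_num) hd)
    nlinarith
  exact fun bd => isUnit_of_near_unitary (hU₀ bd) (hU bd) hε1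

/-- ★★★ `U ↦ C(U,U⁻¹)` IS ANALYTIC AT EVERY POINT OF THE CLOSED POLYDISC `‖U_b − U₀_b‖ ≤ ε`, `Lε ≤ s₀(m²,0,d)`, around every unitary `U₀`. [cite: Balaban1985BackgroundPropagators, Thm 3.4 p.400; King1986, (4.45) p.675] -/
theorem analyticAt_printBlockCov {U : Tor (fine L M) × Fin (d + 1) → Matrix n n 𝕜} {ε : ℝ} (hε0 : 0 ≤ ε) (hU : ∀ bd, ‖U bd - U₀ bd‖ ≤ ε) (hrad : (L : ℝ) * ε ≤ sliceRadius m2 0 d) :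
    AnalyticAt 𝕜 (fun W : Tor (fine L M) × Fin (d + 1) → Matrix n n 𝕜 => cxBlockCov T M a ((L : ℝ) ^ 2) m2 W (fun bd => (W bd)⁻¹)) U := by
  have hunit := isUnit_links_of_polydisc M hL hU₀ hU hrad
  have hB : IsUnit (cxFullOp T M 0 ((L : ℝ) ^ 2) m2 U (fun bd => (U bd)⁻¹)) :=
    isUnit_cxFullOp_at_radius T M hD le_rfl hm.le hL hU₀ hm (mass_coercive_fullOpU T M le_rfl (by positivity) m2 hU₀) hε0 hU hrad
  have h := (analyticAt_cxBlockCov T M (a := a) (UV₀ := ((U, fun bd => (U bd)⁻¹) : CxLinks (fine L M) 𝕜 n)) hB).comp_of_eq (analyticAt_sliceEmbed M hunit) rfl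
  exact h

/-- ★★★★ **NE2's UNIT LAYER CONTINUES ANALYTICALLY IN THE BACKGROUND ON BAŁABAN's SCALE**: `U ↦ C(U,U⁻¹)` is analytic on the open polydisc `‖U_b − U₀_b‖ < s₀(m²,0,d)∕L` around EVERY unitary
background `U₀` (any curvature; `m² > 0`, `L ≥ 1`, comb-depth contours, any block coupling `a`). [cite: Balaban1985BackgroundPropagators, §3.B p.399 l.37–40, Thm 3.4 p.400; King1986, (4.45) p.675] -/
theorem analyticOnNhd_printBlockCov_polydisc :
    AnalyticOnNhd 𝕜 (fun W : Tor (fine L M) × Fin (d + 1) → Matrix n n 𝕜 => cxBlockCov T M a ((L : ℝ) ^ 2) m2 W (fun bd => (W bd)⁻¹)) {U | ∀ bd, ‖U bd - U₀ bd‖ < sliceRadius m2 0 d / L} := by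
  intro U hU
  have hL0 : (0 : ℝ) < L := by exact_mod_cast hL
  exact analyticAt_printBlockCov T M hD a hm hL hU₀ (div_nonneg (sliceRadius_pos hm le_rfl d).le hL0.le) (fun bd => (hU bd).le) (by rw [mul_div_cancel₀ _ hL0.ne'])

/-- ★★★ EVERY FIBRE BLOCK `U ↦ blk C(U,U⁻¹) y y′` IS HOLOMORPHIC on the polydisc. [cite: Balaban1985BackgroundPropagators, Thm 3.4 p.400; King1986, (4.37) p.674] -/
theorem analyticOnNhd_blk_printBlockCov_polydisc (y y' : Tor M) :
    AnalyticOnNhd 𝕜 (fun W : Tor (fine L M) × Fin (d + 1) → Matrix n n 𝕜 => blk (cxBlockCov T M a ((L : ℝ) ^ 2) m2 W (fun bd => (W bd)⁻¹)) y y') {U | ∀ bd, ‖U bd - U₀ bd‖ < sliceRadius m2 0 d / L} :=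
  fun U hU => ((cxBlkCLM M 𝕜 n y y').analyticAt _).comp (analyticOnNhd_printBlockCov_polydisc T M hD a hm hL hU₀ U hU)

/-- ★★★ EVERY ENTRY `U ↦ C(U,U⁻¹)(p,p′)` IS HOLOMORPHIC on the polydisc. [cite: Balaban1985BackgroundPropagators, Thm 3.4 p.400] -/
theorem analyticOnNhd_printBlockCov_entry_polydisc (p p' : Tor M × n) :
    AnalyticOnNhd 𝕜 (fun W : Tor (fine L M) × Fin (d + 1) → Matrix n n 𝕜 => cxBlockCov T M a ((L : ℝ) ^ 2) m2 W (fun bd => (W bd)⁻¹) p p') {U | ∀ bd, ‖U bd - U₀ bd‖ < sliceRadius m2 0 d / L} :=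
  fun U hU => ((cxEntryCLM M 𝕜 p p').analyticAt _).comp (analyticOnNhd_printBlockCov_polydisc T M hD a hm hL hU₀ U hU)

/-- `U ↦ C(U,U⁻¹)` is continuous on the polydisc. [cite: Balaban1985BackgroundPropagators, Thm 3.4 p.400] -/
theorem continuousOn_printBlockCov_polydisc :
    ContinuousOn (fun W : Tor (fine L M) × Fin (d + 1) → Matrix n n 𝕜 => cxBlockCov T M a ((L : ℝ) ^ 2) m2 W (fun bd => (W bd)⁻¹)) {U | ∀ bd, ‖U bd - U₀ bd‖ < sliceRadius m2 0 d / L} :=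
  (analyticOnNhd_printBlockCov_polydisc T M hD a hm hL hU₀).continuousOn

omit hm in
/-- ★★★★ **THE INVERSE OF KING's CONTINUED EFFECTIVE LAPLACIAN IS HOLOMORPHIC ON THE POLYDISC** `‖U_b − U₀_b‖ < s₀(m²,a,d)∕L` (`a, m² > 0`) around every unitary background — there it IS the
Woodbury form (PART Ϫ-b), which is analytic on the larger polydisc. [cite: King1986, (2.14) p.653, (4.44)–(4.45) p.675; Balaban1985BackgroundPropagators, Thm 3.4 p.400] -/
theorem analyticOnNhd_inv_printEffLap_polydisc {a m2 : ℝ} (ha : 0 < a) (hm : 0 < m2) :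
    AnalyticOnNhd 𝕜 (fun W : Tor (fine L M) × Fin (d + 1) → Matrix n n 𝕜 => (cxEffLap T M a ((L : ℝ) ^ 2) m2 W (fun bd => (W bd)⁻¹))⁻¹) {U | ∀ bd, ‖U bd - U₀ bd‖ < sliceRadius m2 a d / L} := by
  have hL0 : (0 : ℝ) < L := by exact_mod_cast hL
  have hsub : {U : Tor (fine L M) × Fin (d + 1) → Matrix n n 𝕜 | ∀ bd, ‖U bd - U₀ bd‖ < sliceRadius m2 a d / L} ⊆ {U | ∀ bd, ‖U bd - U₀ bd‖ < sliceRadius m2 0 d / L} :=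
    fun U hU bd => (hU bd).trans_le (div_le_div_of_nonneg_right (sliceRadius_anti hm.le ha.le d) hL0.le)
  refine AnalyticOnNhd.congr (isOpen_polydisc M U₀ _) ((analyticOnNhd_printBlockCov_polydisc T M hD a hm hL hU₀).mono hsub) fun U hU => ?_
  exact (inv_cxEffLap_at_massRadius T M hD ha hm hL hU₀ (div_nonneg (sliceRadius_pos hm ha.le d).le hL0.le) (fun bd => (hU bd).le) (by rw [mul_div_cancel₀ _ hL0.ne'])).symm

end Slice

/-! ## §4 The continued effective Laplacian itself (PART Ϩ-m upgraded to matrix values) -/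

section EffLap

variable (hD : ∀ j, T.depth j ≤ (d + 1) * (L - 1)) {a m2 : ℝ} (ha : 0 ≤ a) (hm : 0 ≤ m2) (hL : 1 ≤ L)
variable {U₀ : Tor (fine L M) × Fin (d + 1) → Matrix n n 𝕜} (hU₀ : ∀ bd, U₀ bd ∈ Matrix.unitaryGroup n 𝕜) {κ : ℝ} (hκ : 0 < κ)
  (hcoer : ∀ v : Tor (fine L M) × n → 𝕜, κ * ∑ x, ‖fib (fine L M) v x‖ ^ 2 ≤ RCLike.re (star v ⬝ᵥ (fullOpU T M a ((L : ℝ) ^ 2) m2 U₀ *ᵥ v)))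
include hD ha hm hL hU₀ hκ hcoer

/-- ★★★ **`U ↦ Δ_eff(U,U⁻¹)` IS ANALYTIC (MATRIX-VALUED) ON THE POLYDISC `‖U_b − U₀_b‖ < s₀(κ,a,d)∕L`** around a unitary `κ`-coercive `U₀` (PART Ϩ-m had every entry).
[cite: King1986, (2.14) p.653, (4.34) p.674; Balaban1985BackgroundPropagators, Thm 3.4 p.400] -/
theorem analyticOnNhd_printEffLap_polydisc :
    AnalyticOnNhd 𝕜 (fun W : Tor (fine L M) × Fin (d + 1) → Matrix n n 𝕜 => cxEffLap T M a ((L : ℝ) ^ 2) m2 W (fun bd => (W bd)⁻¹)) {U | ∀ bd, ‖U bd - U₀ bd‖ < sliceRadius κ a d / L} := by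
  intro U hU
  have hL0 : (0 : ℝ) < L := by exact_mod_cast hL
  have hU' : ∀ bd, ‖U bd - U₀ bd‖ ≤ sliceRadius κ a d / L := fun bd => (hU bd).le
  have hrad : (L : ℝ) * (sliceRadius κ a d / L) ≤ sliceRadius κ a d := by rw [mul_div_cancel₀ _ hL0.ne']
  have hunit := isUnit_links_of_polydisc M hL hU₀ hU' hrad
  have hA : IsUnit (cxFullOp T M a ((L : ℝ) ^ 2) m2 U (fun bd => (U bd)⁻¹)) :=
    isUnit_cxFullOp_at_radius T M hD ha hm hL hU₀ hκ hcoer (div_nonneg (sliceRadius_pos hκ ha d).le hL0.le) hU' hrad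
  have h := (analyticAt_cxEffLap T M (UV₀ := ((U, fun bd => (U bd)⁻¹) : CxLinks (fine L M) 𝕜 n)) hA).comp_of_eq (analyticAt_sliceEmbed M hunit) rfl
  exact h

end EffLap

end Summit.QuantumFields.YangMills.BalabanUVNodes.N15KingModelRung.Analytic

end
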